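import Literature.Geometry.Lorentzian.LeviCivitaCurvature
import Literature.Geometry.Lorentzian.ChartCalculus
import Mathlib.Geometry.Manifold.VectorBundle.LocalFrame
import Mathlib.Geometry.Manifold.Algebra.Structures
import Mathlib.LinearAlgebra.Matrix.NonsingularInverse
import Mathlib.LinearAlgebra.Matrix.BilinearForm
import HarnessLib

/-!
# The curvature, Ricci and scalar curvature of a smooth metric are smooth

Regularity companion of `Curvature.lean` / `CurvatureProofs.lean` / `LeviCivitaProofs.lean`
(trunk T-LORENTZ / G08). O'Neill 1983, Ch. 3: the curvature `R` of the Levi-Civita connection is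
a *tensor field* (Lemma 3.35), `Ric = C¹₃(R) ∈ 𝔗⁰₂(M)` (Def. 3.51) and "the scalar curvature `S`
of `M` is the contraction `C(Ric) ∈ 𝔉(M)`" (Def. 3.53) — all of them smooth. In the tree the
curvature of a covariant derivative `cov` on `TM` is the pointwise trilinear map
`CovariantDerivative.curvature cov x` (junk `0` where no tensor exists), the Ricci tensor is its
trace and the scalar curvature is the metric trace `g.trace x (cov.ricci x)`
(`PseudoRiemannianMetric.scalarCurvature`, and `scalarCurvatureWith` in
`Literature/Geometry/Riemannian/RicciFlowScalarCurvature.lean`); this file proves that these are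
`C^∞` functions of `x` for a `C^∞` metric `g` and any covariant derivative that is locally `C¹`
and locally `C^∞` — in particular for every Levi-Civita connection of `g`
(`IsLeviCivita.isLocallyContMDiff`, `LeviCivitaCurvature.lean`), discharging the regularity
input `contMDiff_scalarCurvatureWith` of the Ricci-flow layer (see
`Literature/Geometry/Riemannian/RicciFlowScalarCurvatureProofs.lean`).

## Proof

Near `x₀` let `sᵢ` be the local frame of `TM` induced by the trivialization at `x₀` and a basis
of the model space (Mathlib's `Trivialization.localFrame`, smooth on the base set, with coefficient
functionals `localFrame_coeff`, smooth on smooth sections). Then on the base set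

* `y ↦ R_y(X_y, Y_y) Z_y` is `C^∞` for `C^∞` fields `X, Y, Z` (`contMDiffOn_curvature_apply`):
  by `CovariantDerivative.curvature_apply_of_isLocallyContMDiff` it is
  `∇_X ∇_Y Z - ∇_Y ∇_X Z - ∇_{[X,Y]} Z`, and a locally `C^∞` covariant derivative maps `C^∞`
  fields to `C^∞` sections of `Hom(TM, TM)` (Mathlib's `ContMDiffOn.clm_bundle_apply`,
  `ContMDiffAt.mlieBracket_vectorField`);
* `Ric_x(Y_x, Z_x) = ∑ₖ coeffₖ(R_x(sₖ, Y_x) Z_x)` (trace in the basis `sₖ x`), smooth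
  (`contMDiffOn_ricci_apply`);
* `tr_g T = ∑ᵢⱼ (G⁻¹)ⱼᵢ T(sᵢ, sⱼ)` with `G` the Gram matrix of the frame (`trace_eq_sum_gram_inv`,
  `gram_inv_eq`: the matrix `(sⁱ(♯ sʲ))` is `(G⁻¹)ᵀ`), whose inverse has smooth entries
  (`contMDiffAt_matrix_inv`: adjugate over determinant, Leibniz expansions), so
  `x ↦ tr_g Ric(x)` is smooth (`contMDiffOn_trace_ricci_baseSet`, `contMDiff_trace_ricci`).

Main statements: `contMDiff_curvature_apply`, `contMDiff_ricci_apply`, `contMDiff_trace_ricci`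
(covariant derivative locally `C¹` and `C^∞`), `IsLeviCivita.contMDiff_trace_ricci`,
`IsLeviCivita.contMDiff_ricci_apply` (any Levi-Civita connection of a `C^∞` metric),
`PseudoRiemannianMetric.contMDiff_scalarCurvature`, `contMDiff_ricci_apply'`,
`contMDiff_riemann_apply` (the curvature tensors of `g` itself). Only the `C^∞` case is treated.

## References

* [ONeill1983] B. O'Neill, *Semi-Riemannian geometry with applications to relativity*, Academic
  Press 1983, Ch. 3, Lemma 3.35 (`R` is a tensor field), Def. 3.51 (Ricci), Def. 3.53 (scalar
  curvature `C(Ric) ∈ 𝔉(M)`), pp. 60–61 (metric contraction).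
* [GallotHulinLafontaine2004] S. Gallot, D. Hulin, J. Lafontaine, *Riemannian Geometry*, 3rd
  ed., Springer 2004, Prop. 2.54 and 3.A (curvature in coordinates).
-/

noncomputable section

open Bundle Set NormedSpace FiberBundle VectorField Matrix
open scoped Manifold ContDiff Topology BigOperators

namespace Literature.Geometry.Lorentzian

/-! ### Smooth matrix-valued functions, entrywise -/

section MatrixCalculus

variable {EM : Type*} [NormedAddCommGroup EM] [NormedSpace ℝ EM] {HM : Type*}
  [TopologicalSpace HM] {I : ModelWithCorners ℝ EM HM} {M : Type*} [TopologicalSpace M]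
  [ChartedSpace HM M] {ι : Type*} [Fintype ι] [DecidableEq ι] {k : ℕ∞ω}
  {A : M → Matrix ι ι ℝ} {x₀ : M}

/-- **The determinant of a matrix of `C^k` functions is `C^k`** (Leibniz expansion
`det A = ∑_σ ε(σ) ∏ᵢ A_{σ(i) i}`, Mathlib's `Matrix.det_apply'`). [folklore] -/
theorem contMDiffAt_matrix_det (hA : ∀ i j, CMDiffAt k (fun x ↦ A x i j) x₀) :
    CMDiffAt k (fun x ↦ (A x).det) x₀ := by
  simp only [Matrix.det_apply']
  refine contMDiffAt_finsetSum fun σ _ ↦ ?_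
  exact contMDiffAt_const.mul (contMDiffAt_finsetProd fun i _ ↦ hA _ _)

/-- The entries of the adjugate of a matrix of `C^k` functions are `C^k` (each is a
determinant, `Matrix.adjugate_apply`). [folklore] -/
theorem contMDiffAt_matrix_adjugate (hA : ∀ i j, CMDiffAt k (fun x ↦ A x i j) x₀) (i j : ι) :
    CMDiffAt k (fun x ↦ (A x).adjugate i j) x₀ := by
  simp only [Matrix.adjugate_apply]
  refine contMDiffAt_matrix_det fun i' j' ↦ ?_
  by_cases h : i' = j
  · simp only [h, Matrix.updateRow_self]
    exact contMDiffAt_const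
  · simp only [Matrix.updateRow_ne h]
    exact hA i' j'

/-- **The entries of the inverse of a matrix of `C^k` functions are `C^k` where the determinant
does not vanish** (`A⁻¹ = (det A)⁻¹ • adj A`, `Matrix.inv_def`). [folklore] -/
theorem contMDiffAt_matrix_inv (hA : ∀ i j, CMDiffAt k (fun x ↦ A x i j) x₀)
    (h0 : (A x₀).det ≠ 0) (i j : ι) : CMDiffAt k (fun x ↦ (A x)⁻¹ i j) x₀ := by
  simp only [Matrix.inv_def, Matrix.smul_apply, smul_eq_mul, Ring.inverse_eq_inv']
  exact ((contMDiffAt_matrix_det hA).inv₀ h0).mul (contMDiffAt_matrix_adjugate hA i j)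

end MatrixCalculus

/-! ### Linear algebra: `♯` and the metric trace in a basis -/

section SharpBasis

variable {B : Type*} [TopologicalSpace B] {EB : Type*} [NormedAddCommGroup EB] [NormedSpace ℝ EB]
  {HB : Type*} [TopologicalSpace HB] [ChartedSpace HB B] {IB : ModelWithCorners ℝ EB HB}
  {n' : ℕ∞ω}
  {F' : Type*} [NormedAddCommGroup F'] [NormedSpace ℝ F'] {V : B → Type*}
  [TopologicalSpace (TotalSpace F' V)] [∀ b, TopologicalSpace (V b)] [∀ b, AddCommGroup (V b)]
  [∀ b, Module ℝ (V b)] [FiberBundle F' V] [VectorBundle ℝ F' V] [FiniteDimensional ℝ F']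
  {ι : Type*} [Fintype ι] [DecidableEq ι]

/-- **The inverse Gram matrix is the matrix of `♯`**: for a basis `β` of the fibre with dual
basis `βⁱ = β.coord i`, the Gram matrix `Gᵢⱼ = g_b(βᵢ, βⱼ)` is invertible and
`G⁻¹ = (βⁱ(♯ βʲ))ᵀ` — from `g_b(♯ βʲ, β_l) = βʲ(β_l) = δ_{jl}` (O'Neill 1983, Ch. 3, p. 60:
metrically equivalent vectors and covectors, `g^{ij}` the inverse matrix). [cite: ONeill1983, Ch. 3, p. 60] -/
theorem gram_inv_eq (g' : PseudoRiemannianMetric IB n' F' V) (b : B) (β : Module.Basis ι ℝ (V b)) :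
    (Matrix.of fun i j ↦ g'.val b (β i) (β j))⁻¹ =
      (Matrix.of fun i j ↦ β.coord i (g'.sharp b (β.coord j)))ᵀ := by
  apply Matrix.inv_eq_left_inv
  ext j l
  simp only [Matrix.mul_apply, Matrix.transpose_apply, Matrix.of_apply, Matrix.one_apply]
  have expand : ∀ c : ι → ℝ,
      g'.val b (∑ i, c i • β i) (β l) = ∑ i, c i * g'.val b (β i) (β l) := by
    intro c
    simp only [map_sum, map_smul, FunLike.coe_sum, Finset.sum_apply,
      FunLike.coe_smul, Pi.smul_apply, smul_eq_mul]
  have key : ∑ i, β.coord i (g'.sharp b (β.coord j)) * g'.val b (β i) (β l) =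
      g'.val b (g'.sharp b (β.coord j)) (β l) := by
    conv_rhs => rw [← β.sum_repr (g'.sharp b (β.coord j))]
    rw [expand]
    simp only [Module.Basis.coord_apply]
  rw [key, g'.val_sharp_apply, Module.Basis.coord_apply, β.repr_self, Finsupp.single_apply]
  by_cases h : j = l
  · simp [h]
  · simp [h, Ne.symm h]

/-- **The metric trace in a basis**: `tr_g T = ∑ᵢⱼ (G⁻¹)ⱼᵢ T(βᵢ, βⱼ) = g^{ij} T_{ij}` with `G`
the Gram matrix of the basis `β` (O'Neill 1983, Ch. 3, pp. 60–61, metric contraction; the tree's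
`g.trace` is `tr (♯ ∘ T)`, expanded by `OpensChart.trace_comp_bilinForm_eq_sum` and
`gram_inv_eq`). [cite: ONeill1983, Ch. 3, pp. 60–61] -/
theorem trace_eq_sum_gram_inv (g' : PseudoRiemannianMetric IB n' F' V) (b : B)
    (β : Module.Basis ι ℝ (V b)) (T : LinearMap.BilinForm ℝ (V b)) :
    g'.trace b T = ∑ i, ∑ j, (Matrix.of fun i j ↦ g'.val b (β i) (β j))⁻¹ j i * T (β i) (β j) := by
  haveI := VectorBundle.finiteDimensional ℝ F' V b
  rw [gram_inv_eq]
  simp only [Matrix.transpose_apply, Matrix.of_apply]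
  -- `trace_comp_bilinForm_eq_sum` of `ChartCalculus.lean`
  rw [PseudoRiemannianMetric.trace, LinearMap.trace_eq_matrix_trace ℝ β, Matrix.trace]
  refine Finset.sum_congr rfl fun i _ ↦ ?_
  rw [Matrix.diag_apply, LinearMap.toMatrix_apply, LinearMap.comp_apply]
  conv_lhs => rw [← β.sum_dual_apply_smul_coord (T (β i))]
  rw [map_sum, map_sum, Finsupp.finsetSum_apply]
  refine Finset.sum_congr rfl fun j _ ↦ ?_
  rw [map_smul, map_smul, Finsupp.smul_apply, smul_eq_mul, mul_comm]
  rfl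

omit [FiniteDimensional ℝ F'] in
/-- The Gram matrix of a nondegenerate form in a basis has nonzero determinant (Mathlib's
`LinearMap.BilinForm.nondegenerate_iff_det_ne_zero`). [folklore] -/
theorem det_gram_ne_zero (g' : PseudoRiemannianMetric IB n' F' V) (b : B)
    (β : Module.Basis ι ℝ (V b)) : (Matrix.of fun i j ↦ g'.val b (β i) (β j)).det ≠ 0 := by
  have h : (LinearMap.BilinForm.toMatrix β (g'.toBilinForm b)).det ≠ 0 :=
    (LinearMap.BilinForm.nondegenerate_iff_det_ne_zero β).1 (g'.nondegenerate_toBilinForm b)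
  convert h using 2
  ext i j
  rw [Matrix.of_apply, LinearMap.BilinForm.toMatrix_apply, PseudoRiemannianMetric.toBilinForm_apply]

end SharpBasis

/-! ### Smoothness of curvature, Ricci and scalar curvature components in a local frame -/

section Frame

variable {E : Type*} [NormedAddCommGroup E] [NormedSpace ℝ E] {H : Type*} [TopologicalSpace H]
  {I : ModelWithCorners ℝ E H} {M : Type*} [TopologicalSpace M] [ChartedSpace H M]
  [IsManifold I ∞ M] {cov : CovariantDerivative I E (TangentSpace I : M → Type _)}

variable [FiniteDimensional ℝ E] [CompleteSpace E]

/-- **The curvature of smooth fields is a smooth field** (O'Neill 1983, Ch. 3, Lemma 3.35: `R`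
is a tensor field on `M`). For a covariant derivative `cov` on `TM` which is locally `C¹` and
locally `C^∞`, and vector fields `X, Y, Z` of class `C^∞` on an open set `u`, the field
`y ↦ R_y(X_y, Y_y) Z_y` is `C^∞` on `u`: by `CovariantDerivative.curvature_apply_of_isLocallyContMDiff`
it is `∇_X ∇_Y Z - ∇_Y ∇_X Z - ∇_{[X,Y]} Z` there, and each term is `C^∞` (Mathlib's
`ContMDiffOn.clm_bundle_apply`, `ContMDiffAt.mlieBracket_vectorField`).
[cite: ONeill1983, Ch. 3, Lemma 3.35] -/
theorem contMDiffOn_curvature_apply (h1 : cov.IsLocallyContMDiff 1)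
    (hinf : cov.IsLocallyContMDiff (⊤ : ℕ∞)) {u : Set M} (hu : IsOpen u)
    {X Y Z : Π x : M, TangentSpace I x} (hX : CMDiff[u] ∞ (T% X)) (hY : CMDiff[u] ∞ (T% Y))
    (hZ : CMDiff[u] ∞ (T% Z)) :
    CMDiff[u] ∞ (T% (fun y ↦ cov.curvature y (X y) (Y y) (Z y))) := by
  have hI3 : IsManifold I (minSmoothness ℝ 3) M := by
    rw [minSmoothness_of_isRCLikeNormedField]; infer_instance
  have htop : (((⊤ : ℕ∞) : ℕ∞ω)) = ∞ := rfl
  -- `∇ Z` is `C^∞` on `u`, hence so are `∇_Y Z`, `∇_X Z`, `∇_{[X,Y]} Z`, `∇_X ∇_Y Z`, `∇_Y ∇_X Z`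
  have hDZ : ContMDiffOn I (I.prod 𝓘(ℝ, E →L[ℝ] E)) ∞ (cov.totalCovDeriv Z) u :=
    (hinf u hu).contMDiff (by simpa [htop] using hZ)
  have hYZ : CMDiff[u] ∞ (T% (fun y ↦ cov Z y (Y y))) := hDZ.clm_bundle_apply hY
  have hXZ : CMDiff[u] ∞ (T% (fun y ↦ cov Z y (X y))) := hDZ.clm_bundle_apply hX
  have hDYZ : ContMDiffOn I (I.prod 𝓘(ℝ, E →L[ℝ] E)) ∞
      (cov.totalCovDeriv (fun y ↦ cov Z y (Y y))) u :=
    (hinf u hu).contMDiff (by simpa [htop] using hYZ)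
  have hDXZ : ContMDiffOn I (I.prod 𝓘(ℝ, E →L[ℝ] E)) ∞
      (cov.totalCovDeriv (fun y ↦ cov Z y (X y))) u :=
    (hinf u hu).contMDiff (by simpa [htop] using hXZ)
  have hA : CMDiff[u] ∞ (T% (fun y ↦ cov (fun y ↦ cov Z y (Y y)) y (X y))) :=
    hDYZ.clm_bundle_apply hX
  have hB : CMDiff[u] ∞ (T% (fun y ↦ cov (fun y ↦ cov Z y (X y)) y (Y y))) :=
    hDXZ.clm_bundle_apply hY
  have hbr : CMDiff[u] ∞ (T% (mlieBracket I X Y)) := by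
    intro y hy
    haveI : IsManifold I (((⊤ : ℕ∞) : ℕ∞ω) + 1) M := by
      rw [htop, show (∞ : ℕ∞ω) + 1 = ∞ by rfl]; infer_instance
    have hXy : CMDiffAt ((⊤ : ℕ∞) : ℕ∞ω) (T% X) y := (hX y hy).contMDiffAt (hu.mem_nhds hy)
    have hYy : CMDiffAt ((⊤ : ℕ∞) : ℕ∞ω) (T% Y) y := (hY y hy).contMDiffAt (hu.mem_nhds hy)
    exact (hXy.mlieBracket_vectorField hYy (m := ⊤) (by simp)).contMDiffWithinAt
  have hC : CMDiff[u] ∞ (T% (fun y ↦ cov Z y (mlieBracket I X Y y))) := hDZ.clm_bundle_apply hbr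
  have haux : CMDiff[u] ∞ (T% (CovariantDerivative.curvatureAux cov X Y Z)) := by
    have := (hA.sub_section hB).sub_section hC
    refine this.congr fun y _ ↦ ?_
    simp [CovariantDerivative.curvatureAux]
  refine haux.congr fun y hy ↦ ?_
  have h2 : (2 : ℕ∞ω) ≤ ∞ := WithTop.coe_le_coe.mpr le_top
  rw [Bundle.TotalSpace.mk_inj]
  exact cov.curvature_apply_of_isLocallyContMDiff h1
    (((hX y hy).contMDiffAt (hu.mem_nhds hy)).mdifferentiableAt (by simp))
    (((hY y hy).contMDiffAt (hu.mem_nhds hy)).mdifferentiableAt (by simp))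
    (((hZ y hy).contMDiffAt (hu.mem_nhds hy)).of_le (by
      rw [minSmoothness_of_isRCLikeNormedField]; exact h2))

variable (e : Trivialization E (TotalSpace.proj : TangentBundle I M → M)) [MemTrivializationAtlas e]

/-- **The Ricci tensor on smooth fields is smooth, locally** (O'Neill 1983, Ch. 3, Def. 3.51:
`Ric = C¹₃(R) ∈ 𝔗⁰₂(M)`). On the base set of a trivialization `e` of the atlas, for `cov` locally
`C¹` and `C^∞` and fields `Y, Z` of class `C^∞` there, `x ↦ Ric_x(Y_x, Z_x)` is `C^∞`: in the local
frame `sₖ` of `e`, `Ric_x(Y_x, Z_x) = tr (v ↦ R_x(v, Y_x) Z_x) = ∑ₖ coeffₖ(x)(R_x(sₖ x, Y_x) Z_x)`,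
the fields `x ↦ R_x(sₖ x, Y_x) Z_x` are `C^∞` (`contMDiffOn_curvature_apply`) and so are their
frame coefficients (Mathlib's `contMDiffAt_localFrame_coeff`). [cite: ONeill1983, Ch. 3, Def. 3.51] -/
theorem contMDiffOn_ricci_apply (h1 : cov.IsLocallyContMDiff 1)
    (hinf : cov.IsLocallyContMDiff (⊤ : ℕ∞)) {Y Z : Π x : M, TangentSpace I x}
    (hY : CMDiff[e.baseSet] ∞ (T% Y)) (hZ : CMDiff[e.baseSet] ∞ (T% Z)) :
    CMDiff[e.baseSet] ∞ (fun x ↦ cov.ricci x (Y x) (Z x)) := by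
  classical
  set bE := Module.finBasis ℝ E with hbE
  -- the frame fields and the curvature fields `W k x = R_x(s_k x, Y x) Z x`
  set s : Fin (Module.finrank ℝ E) → Π x : M, TangentSpace I x := e.localFrame bE with hsdef
  have hs : ∀ k, CMDiff[e.baseSet] ∞ (T% (s k)) := fun k ↦
    e.contMDiffOn_localFrame_baseSet (I := I) ∞ bE k
  set W : Fin (Module.finrank ℝ E) → Π x : M, TangentSpace I x :=
    fun k x ↦ cov.curvature x (s k x) (Y x) (Z x) with hW
  have hWs : ∀ k, CMDiff[e.baseSet] ∞ (T% (W k)) := fun k ↦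
    contMDiffOn_curvature_apply h1 hinf e.open_baseSet (hs k) hY hZ
  -- the formula on the base set
  have formula : ∀ x ∈ e.baseSet,
      cov.ricci x (Y x) (Z x) = ∑ k, e.localFrame_coeff I bE k x (W k x) := by
    intro x hx
    haveI : FiniteDimensional ℝ (TangentSpace I x) := ‹FiniteDimensional ℝ E›
    rw [CovariantDerivative.ricci_apply, LinearMap.trace_eq_matrix_trace ℝ (e.basisAt bE hx),
      Matrix.trace]
    refine Finset.sum_congr rfl fun k _ ↦ ?_
    rw [Matrix.diag_apply, LinearMap.toMatrix_apply, CovariantDerivative.ricciAux_apply,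
      e.localFrame_coeff_apply_of_mem_baseSet bE hx, hW]
    simp only [hsdef, e.localFrame_apply_of_mem_baseSet bE hx]
  -- smoothness of the right-hand side
  have hrhs : CMDiff[e.baseSet] ∞ (fun x ↦ ∑ k, e.localFrame_coeff I bE k x (W k x)) := by
    intro x hx
    refine (contMDiffAt_finsetSum fun k _ ↦ ?_).contMDiffWithinAt
    exact contMDiffAt_localFrame_coeff bE hx ((hWs k x hx).contMDiffAt
      (e.open_baseSet.mem_nhds hx)) k
  exact hrhs.congr formula

variable (g : PseudoRiemannianMetric I ∞ E (TangentSpace I : M → Type _))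

omit [FiniteDimensional ℝ E] [CompleteSpace E] in
/-- The entries `G(x)ᵢⱼ = g_x(sᵢ x, sⱼ x)` of the Gram matrix of the local frame are `C^∞` on
the base set (`contMDiffAt_val_apply`). [folklore] -/
theorem contMDiffOn_gram_localFrame {ι : Type*} (bE : Module.Basis ι ℝ E) (i j : ι) :
    CMDiff[e.baseSet] ∞ (fun x ↦ g.val x (e.localFrame bE i x) (e.localFrame bE j x)) := by
  intro x hx
  have hs := fun k ↦
    (e.contMDiffOn_localFrame_baseSet (I := I) ∞ bE k x hx).contMDiffAt
      (e.open_baseSet.mem_nhds hx)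
  exact (g.contMDiffAt_val_apply le_rfl (hs i) (hs j)).contMDiffWithinAt

omit [FiniteDimensional ℝ E] [CompleteSpace E] in
/-- The Gram matrix of the local frame is invertible on the base set (`det_gram_ne_zero` for
the basis `e.basisAt`). [folklore] -/
theorem det_gram_localFrame_ne_zero {ι : Type*} [Fintype ι] [DecidableEq ι]
    (bE : Module.Basis ι ℝ E) {x : M} (hx : x ∈ e.baseSet) :
    (Matrix.of fun i j ↦ g.val x (e.localFrame bE i x) (e.localFrame bE j x)).det ≠ 0 := by
  have := det_gram_ne_zero g x (e.basisAt bE hx)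
  simpa only [e.localFrame_apply_of_mem_baseSet bE hx] using this

omit [FiniteDimensional ℝ E] [CompleteSpace E] in
/-- **The inverse metric `g^{ij}` in the local frame is smooth**: the entries of the inverse
Gram matrix are `C^∞` on the base set (`contMDiffAt_matrix_inv`). [folklore] -/
theorem contMDiffOn_gram_localFrame_inv {ι : Type*} [Fintype ι] [DecidableEq ι]
    (bE : Module.Basis ι ℝ E) (i j : ι) :
    CMDiff[e.baseSet] ∞ (fun x ↦
      (Matrix.of fun i j ↦ g.val x (e.localFrame bE i x) (e.localFrame bE j x))⁻¹ i j) :=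
  fun x hx ↦ (contMDiffAt_matrix_inv
    (A := fun x ↦ Matrix.of fun i j ↦ g.val x (e.localFrame bE i x) (e.localFrame bE j x))
    (fun i j ↦ (contMDiffOn_gram_localFrame e g bE i j x hx).contMDiffAt
      (e.open_baseSet.mem_nhds hx)) (det_gram_localFrame_ne_zero e g bE hx) i j).contMDiffWithinAt

/-- **The scalar curvature is smooth, locally** (O'Neill 1983, Ch. 3, Def. 3.53:
`S = C(Ric) ∈ 𝔉(M)`): on the base set of a trivialization of the atlas,
`tr_g Ric(cov)_x = ∑ᵢⱼ (G(x)⁻¹)ⱼᵢ Ric_x(sᵢ x, sⱼ x)` (`trace_eq_sum_gram_inv` in the frame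
`sᵢ`), a finite sum of products of `C^∞` functions (`contMDiffOn_gram_localFrame_inv`,
`contMDiffOn_ricci_apply`). [cite: ONeill1983, Ch. 3, Def. 3.53] -/
theorem contMDiffOn_trace_ricci_baseSet (h1 : cov.IsLocallyContMDiff 1)
    (hinf : cov.IsLocallyContMDiff (⊤ : ℕ∞)) :
    CMDiff[e.baseSet] ∞ (fun x ↦ g.trace x (cov.ricci x)) := by
  classical
  set bE := Module.finBasis ℝ E with hbE
  have formula : ∀ x ∈ e.baseSet, g.trace x (cov.ricci x) =
      ∑ i, ∑ j, (Matrix.of fun i j ↦ g.val x (e.localFrame bE i x) (e.localFrame bE j x))⁻¹ j i *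
        cov.ricci x (e.localFrame bE i x) (e.localFrame bE j x) := by
    intro x hx
    rw [trace_eq_sum_gram_inv g x (e.basisAt bE hx)]
    simp only [e.localFrame_apply_of_mem_baseSet bE hx]
  have hrhs : CMDiff[e.baseSet] ∞ (fun x ↦
      ∑ i, ∑ j, (Matrix.of fun i j ↦ g.val x (e.localFrame bE i x) (e.localFrame bE j x))⁻¹ j i *
        cov.ricci x (e.localFrame bE i x) (e.localFrame bE j x)) := by
    intro x hx
    refine (contMDiffAt_finsetSum fun i _ ↦ contMDiffAt_finsetSum fun j _ ↦ ?_).contMDiffWithinAt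
    refine ((contMDiffOn_gram_localFrame_inv e g bE j i x hx).contMDiffAt
      (e.open_baseSet.mem_nhds hx)).mul ?_
    exact (contMDiffOn_ricci_apply e h1 hinf (e.contMDiffOn_localFrame_baseSet (I := I) ∞ bE i)
      (e.contMDiffOn_localFrame_baseSet (I := I) ∞ bE j) x hx).contMDiffAt
      (e.open_baseSet.mem_nhds hx)
  exact hrhs.congr formula

/-! ### Global statements -/

/-- **The scalar curvature `x ↦ tr_g Ric(cov)_x` is `C^∞`** for a `C^∞` metric `g` and a
covariant derivative `cov` on `TM` which is locally `C¹` and locally `C^∞` (O'Neill 1983, Ch. 3,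
Def. 3.53), from `contMDiffOn_trace_ricci_baseSet` at the trivialization at each point.
[cite: ONeill1983, Ch. 3, Def. 3.53] -/
theorem contMDiff_trace_ricci (h1 : cov.IsLocallyContMDiff 1)
    (hinf : cov.IsLocallyContMDiff (⊤ : ℕ∞)) : CMDiff ∞ (fun x ↦ g.trace x (cov.ricci x)) := by
  intro x₀
  have hx₀ := mem_baseSet_trivializationAt E (TangentSpace I : M → Type _) x₀
  exact (contMDiffOn_trace_ricci_baseSet (trivializationAt E (TangentSpace I : M → Type _) x₀)
    g h1 hinf x₀ hx₀).contMDiffAt ((trivializationAt E (TangentSpace I : M → Type _) x₀).open_baseSet.mem_nhds hx₀)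

/-- **The Ricci tensor evaluated on smooth fields is smooth** (O'Neill 1983, Ch. 3, Def. 3.51):
for `cov` locally `C¹` and locally `C^∞` and `C^∞` vector fields `Y`, `Z`, the function
`x ↦ Ric(cov)_x(Y_x, Z_x)` is `C^∞`. [cite: ONeill1983, Ch. 3, Def. 3.51] -/
theorem contMDiff_ricci_apply (h1 : cov.IsLocallyContMDiff 1)
    (hinf : cov.IsLocallyContMDiff (⊤ : ℕ∞)) {Y Z : Π x : M, TangentSpace I x}
    (hY : CMDiff ∞ (T% Y)) (hZ : CMDiff ∞ (T% Z)) :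
    CMDiff ∞ (fun x ↦ cov.ricci x (Y x) (Z x)) := by
  intro x₀
  have hx₀ := mem_baseSet_trivializationAt E (TangentSpace I : M → Type _) x₀
  exact (contMDiffOn_ricci_apply (trivializationAt E (TangentSpace I : M → Type _) x₀) h1 hinf
    hY.contMDiffOn hZ.contMDiffOn x₀ hx₀).contMDiffAt
    ((trivializationAt E (TangentSpace I : M → Type _) x₀).open_baseSet.mem_nhds hx₀)

/-- **The curvature tensor evaluated on smooth fields is a smooth field** (O'Neill 1983, Ch. 3,
Lemma 3.35), global form of `contMDiffOn_curvature_apply`. [cite: ONeill1983, Ch. 3, Lemma 3.35] -/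
theorem contMDiff_curvature_apply (h1 : cov.IsLocallyContMDiff 1)
    (hinf : cov.IsLocallyContMDiff (⊤ : ℕ∞)) {X Y Z : Π x : M, TangentSpace I x}
    (hX : CMDiff ∞ (T% X)) (hY : CMDiff ∞ (T% Y)) (hZ : CMDiff ∞ (T% Z)) :
    CMDiff ∞ (T% (fun y ↦ cov.curvature y (X y) (Y y) (Z y))) := by
  rw [← contMDiffOn_univ] at hX hY hZ ⊢
  exact contMDiffOn_curvature_apply h1 hinf isOpen_univ hX hY hZ

namespace PseudoRiemannianMetric

variable {g}

/-- **The scalar curvature of `(g, cov)` is smooth for any Levi-Civita connection `cov` of the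
`C^∞` metric `g`** (O'Neill 1983, Ch. 3, Def. 3.53 with Thm. 3.11) — the regularity consumed by
`Literature/Geometry/Riemannian/` (named fact `contMDiff_scalarCurvatureWith`): such a `cov` is
locally `C¹` and locally `C^∞` (`IsLeviCivita.isLocallyContMDiff`). [cite: ONeill1983, Ch. 3, Def. 3.53] -/
theorem IsLeviCivita.contMDiff_trace_ricci (h : g.IsLeviCivita cov) :
    CMDiff ∞ (fun x ↦ g.trace x (cov.ricci x)) :=
  Lorentzian.contMDiff_trace_ricci g (h.isLocallyContMDiff_one (WithTop.coe_le_coe.mpr le_top))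
    (h.isLocallyContMDiff ⊤ (le_of_eq rfl))

/-- The Ricci tensor of any Levi-Civita connection of the `C^∞` metric `g`, evaluated on `C^∞`
fields, is a `C^∞` function (O'Neill 1983, Ch. 3, Def. 3.51). [cite: ONeill1983, Ch. 3, Def. 3.51] -/
theorem IsLeviCivita.contMDiff_ricci_apply (h : g.IsLeviCivita cov)
    {Y Z : Π x : M, TangentSpace I x} (hY : CMDiff ∞ (T% Y)) (hZ : CMDiff ∞ (T% Z)) :
    CMDiff ∞ (fun x ↦ cov.ricci x (Y x) (Z x)) :=
  Lorentzian.contMDiff_ricci_apply (h.isLocallyContMDiff_one (WithTop.coe_le_coe.mpr le_top))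
    (h.isLocallyContMDiff ⊤ (le_of_eq rfl)) hY hZ

variable (g) [g.HasLeviCivita]

/-- **The scalar curvature of a `C^∞` metric is a `C^∞` function** (O'Neill 1983, Ch. 3,
Def. 3.53: "the scalar curvature `S` of `M` is the contraction `C(Ric) ∈ 𝔉(M)`", `𝔉(M)` the
smooth functions, with Lemma 3.35 and Def. 3.51). [cite: ONeill1983, Ch. 3, Def. 3.53] -/
theorem contMDiff_scalarCurvature : CMDiff ∞ g.scalarCurvature :=
  (isLeviCivita_leviCivita_holds (g := g)).contMDiff_trace_ricci

/-- The Ricci tensor of a `C^∞` metric evaluated on `C^∞` fields is `C^∞` (O'Neill 1983, Ch. 3,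
Def. 3.51: `Ric ∈ 𝔗⁰₂(M)`). [cite: ONeill1983, Ch. 3, Def. 3.51] -/
theorem contMDiff_ricci_apply' {Y Z : Π x : M, TangentSpace I x} (hY : CMDiff ∞ (T% Y))
    (hZ : CMDiff ∞ (T% Z)) : CMDiff ∞ (fun x ↦ g.ricci x (Y x) (Z x)) :=
  (isLeviCivita_leviCivita_holds (g := g)).contMDiff_ricci_apply hY hZ

/-- The Riemann tensor of a `C^∞` metric evaluated on `C^∞` fields is a `C^∞` field (O'Neill
1983, Ch. 3, Lemma 3.35: `R` is a tensor field). [cite: ONeill1983, Ch. 3, Lemma 3.35] -/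
theorem contMDiff_riemann_apply {X Y Z : Π x : M, TangentSpace I x} (hX : CMDiff ∞ (T% X))
    (hY : CMDiff ∞ (T% Y)) (hZ : CMDiff ∞ (T% Z)) :
    CMDiff ∞ (T% (fun y ↦ g.riemann y (X y) (Y y) (Z y))) :=
  contMDiff_curvature_apply
    ((isLeviCivita_leviCivita_holds (g := g)).isLocallyContMDiff_one
      (WithTop.coe_le_coe.mpr le_top))
    ((isLeviCivita_leviCivita_holds (g := g)).isLocallyContMDiff ⊤ (le_of_eq rfl)) hX hY hZ

end PseudoRiemannianMetric

end Frame

end Literature.Geometry.Lorentzian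

end
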